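import Summits.BirchSwinnertonDyer.BirchSwinnertonDyer.Theses.UniversalToricDescent
import Summits.BirchSwinnertonDyer.BirchSwinnertonDyer.Theses.SemiOrdinaryEisensteinDescent
import Summits.BirchSwinnertonDyer.BirchSwinnertonDyer.Theorems.UniversalToricDescentCharIdealVacuity
import Summits.BirchSwinnertonDyer.Rank1Residual.X2.HidaLimitCongruenceAlgebra
import Summits.BirchSwinnertonDyer.Rank1Residual.X11b.HalvesReceptacle
import Mathlib.RingTheory.Polynomial.Cyclotomic.Basic
import Mathlib.RingTheory.PowerSeries.Inverse
import Mathlib.RingTheory.Length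
import HarnessLib

/-!
# NODE `point_anchor` — crux `AdditiveSplitIMCInclusionAtThree` (stmt-BirchSwinnertonDyer-20395, THE WALL, UTD)
# crux-ideate STANDING COVER round 9 (unit cruxidea-stmt-BirchSwinnertonDyer-20395-1-g9), 2026-08-30

D-0171 NODE (`sorry` ONLY inside `stub_*`; `AdditiveSplitIMCInclusionAtThree_of` concludes the crux BY NAME).

THE LEVER.  The wall is the KOLYVAGIN direction `(L) ⊆ Ch·R₀⟦T⟧` on the anticyclotomic line of a
supercuspidal `3`, where every Λ-adic Euler-system supply is dead (barriers `TraceZeroHeegnerTowerAtAdditiveSplitP`,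
`NoAdmissiblePrimesAtThree`, lineage B-g6-2).  `R₀⟦T⟧` is LOCAL, so a unit is detected at ONE closed point:
given the EISENSTEIN inclusion `Ch·R₀⟦T⟧ ⊆ (L)` (route SOED's crux 20479 `WildSplitEisensteinInclusionAtThree`,
cited BY NAME — the opposite half, whose engine is class-free) write `g = L·h`; ONE sharp inequality
`‖L(x)‖ ≤ ‖g(x)‖` at ONE point `x` of the open disc with `L(x) ≠ 0` forces `‖h(x)‖ = 1`, `h(x) ∈ R₀[x]ˣ`,
`h ∈ R₀⟦T⟧ˣ`, `(g) = (L)` — the wall, indeed the full main conjecture at that frame.  The anchor point is the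
trivial character `x = 0` whenever `L(𝟙) ≠ 0` (piece A, `PointAnchorAtThree`: the value-at-𝟙 shadow of the
wall, a TOWER-FREE statement = exact control (UTD 20386, closed) + LZZ `p`-adic Waldspurger (UTD 20385) + the
Manin-robust finite-level Kolyvagin–Jetchev bound of `y_K` (SOED 20480); individual Heegner points and Kolyvagin
primes `ℓ ≡ −1 (3)` EXIST at `p = 3` — only Λ-adic families and BD-admissible primes do not), and a non-trivial
cyclotomic tooth `𝔮_k = (Φ_{3^k}(1+T))` with `𝔮_k ∤ L` on the corner `L(𝟙) = 0 ≠ L` (pieces T + Door).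

PIECES (tags per the NODE contract):
* `stub_eisenstein` — E = SOED item stmt-BirchSwinnertonDyer-20479 `WildSplitEisensteinInclusionAtThree` BY NAME
  (UNDECIDED: the opposite inclusion, incomparable with the crux; E ∧ crux = the split ac IMC at the frame).
  Leaves: IDEA-NEEDED (semi-ordinary U(3,1) Eisenstein family around the supercuspidal `f_E`; SOED's why-might-fail:
  Wan's Fourier–Jacobi non-vanishing mod 3 at `π₃` supercuspidal); BARRIER-adjacent `EisensteinMuConjecture` (μ-part).
* `stub_pointAnchor` — A `PointAnchorAtThree` (WEAKER than the crux: `pointAnchor_of_wall` PROVED).  Leaves: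
  A-ctrl = UTD 20386 `WildSplitControlAtThree` (CLOSED); A-W = UTD 20385 `WildSplitWaldspurgerAtThree` (frame 20928
  aside-open, value half LANDED p540475); A-K = SOED 20480 `WildKolyvaginUpperAtThree` → its research residue SOED 25898
  `WildSigmaDivisibilityAtThreeMultiCarrier` (UNDECIDED, Büyükboduk 2009 Q1) + print parts (ATTACKABLE); A-img: rows with
  ρ̄₃ onto but 3-adic tower not onto are a residual (BARRIER `EulerSystemBigImageAtSmallImage`); A-bk: the bookkeeping
  identity `ord₃ g(0) − ord₃ L(0) = ord₃#Ш + 2·ord₃∏c_q + 2·ord₃ c − 2·ord₃[E(K):ℤP]` (INSTRUMENTABLE, = kernel p528981's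
  `index_eq_of_lower_of_upper` currency).
* `stub_toothDoor` — Door `ToothAnchorDoor` (pure commutative algebra in `R₀⟦T⟧`, ATTACKABLE, M-sized: Weierstrass
  division `R₀⟦T⟧/𝔮_k ≅ R₀[ζ_{3^k}]` is a DVR, lengths add along `0 → (L̄)/(L̄h̄) → S/(L̄h̄) → S/(L̄) → 0`).
* `stub_existsTooth` — `ExistsNonvanishingTooth` (pure algebra, ATTACKABLE, S/M-sized: a non-zero `L ∈ R₀⟦T⟧` lies in
  only finitely many teeth, `∑ φ(3^k) ≤ λ(L)`).
* `stub_toothAnchor` — T `ToothAnchorAtThree` (WEAKER than the crux: `toothAnchor_of_wall` PROVED): on the corner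
  frames `L(𝟙) = 0` (there `r_an(E/K) ≥ 3` by Gross–Zagier + LZZ, so the corner lies OUTSIDE the cone of UTD's `closes`,
  which consumes the wall only at Friedberg–Hoffstein data) the sharp single-tooth inequality at every tooth not dividing
  `L`.  Leaves: IDEA-NEEDED (finite-level Kolyvagin for the `χ_k`-component with the individual class `y_{χ_k}` — which
  survives `TraceZero…` since no trace/norm-compatibility is used — + LZZ Waldspurger at `χ_k` + control at `𝔮_k`);
  INSTRUMENTABLE (does any O6 rank-one row force a corner frame? no: `closes` never meets it).
* PROVED here (no sorry): `isUnit_of_norm_mul_le` (the point-anchor algebra), `pointAnchor_of_wall`,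
  `toothAnchor_of_wall`, `AdditiveSplitIMCInclusionAtThree_of` (E → A → Door → Exists → T → crux), and the
  corner-free form `wallOffCorner_of` (E → A → the wall on every frame with `L(𝟙) ≠ 0`).
COSTUME CHECK: no piece restates the crux (A and T are value/length inequalities at single points, each strictly
implied by the crux; E is the reverse inclusion), the summit, or a negatives entry ({15532, 24881} unrelated).
`L = 0` and the non-torsion locus are handled inside `_of` (`span {0} = ⊥`; `Ch = ⊤` by the landed vacuity theorem).
References: [SkinnerUrban2014] Lem. 3.1.7 (unit detection on a quotient); [JetchevSkinnerWan2017] §7.4 (control +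
value ⇒ index); [Castella2018] Thm. 2.3; [LiuZhangZhang2018] Thm. 1.5.1/1.5.3; [Jetchev2008]; [Kolyvagin1990];
[Gross1991]; [BertoliniDarmon1990] (finite-level Kolyvagin over ring class fields); [Washington1997] §7.1, §13.2.
-/

set_option linter.dupNamespace false
set_option autoImplicit false

noncomputable section

open scoped Classical

open Literature.NumberTheory.EllipticCurves
open Summit.BirchSwinnertonDyer.BirchSwinnertonDyer.Theses.UniversalToricDescent (AdditiveSplitIMCInclusionAtThree)
open Summit.BirchSwinnertonDyer.BirchSwinnertonDyer.Theses.SemiOrdinaryEisensteinDescent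
  (WildSplitEisensteinInclusionAtThree)
open Summit.BirchSwinnertonDyer.BirchSwinnertonDyer.Theorems.UniversalToricDescentCharIdealVacuity
  (span_le_map_charIdeal_of_not_isTorsion)
open Summit.BirchSwinnertonDyer.Rank1Residual.X2.HidaLimitAlgebra (isUnit_of_norm_eq_one)
open Summit.BirchSwinnertonDyer.Rank1Residual.X11b
open Summit.BirchSwinnertonDyer.Rank1Residual.X11b.Halves (norm_coe_unrIntegers_le_one coe_toUnr)

namespace Summit.BirchSwinnertonDyer.BirchSwinnertonDyer.Cruxes.AdditiveSplitIMCInclusionAtThree.PointAnchor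

/-! ## §0 Kernel algebra (no `sorry`) -/

/-- `constantCoeff` commutes with `PowerSeries.map` (local copy of the tree's folklore lemma). [folklore] -/
theorem constantCoeff_map_apply' {𝒪 R₀ : Type*} [CommRing 𝒪] [CommRing R₀] (ι : 𝒪 →+* R₀)
    (f : PowerSeries 𝒪) : PowerSeries.constantCoeff (PowerSeries.map ι f) = ι (PowerSeries.constantCoeff f) := by
  rw [← PowerSeries.coeff_zero_eq_constantCoeff_apply, PowerSeries.coeff_map,
    PowerSeries.coeff_zero_eq_constantCoeff_apply]

/-- **The point-anchor algebra at `𝟙`.** In `R₀`: if `‖a‖ ≤ ‖a·b‖` and `a ≠ 0` then `b` is a unit of `R₀`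
(`‖b‖ ≤ 1` always, so `‖b‖ = 1`, and norm-one elements of the valuation ring `R₀` are units).
[SkinnerUrban2014 Lem. 3.1.7, the case of a closed point; folklore] -/
theorem isUnit_of_norm_mul_le {a b : unrIntegers 3} (ha : a ≠ 0)
    (h : ‖(a : ℂ_[3])‖ ≤ ‖((a * b : unrIntegers 3) : ℂ_[3])‖) : IsUnit b := by
  have ha' : (0 : ℝ) < ‖(a : ℂ_[3])‖ := norm_pos_iff.mpr (fun h0 ↦ ha (Subtype.ext h0))
  rw [Subring.coe_mul, norm_mul] at h
  have h1 : 1 ≤ ‖(b : ℂ_[3])‖ := (le_mul_iff_one_le_right ha').mp h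
  exact isUnit_of_norm_eq_one (le_antisymm (norm_coe_unrIntegers_le_one 3 b) h1)

/-- A power series over `R₀` whose constant term is a unit is a unit, and then `(L·h) = (L)`. [folklore] -/
theorem span_mul_eq_of_isUnit {L h : UnrSeries 3} (hh : IsUnit h) :
    Ideal.span ({L * h} : Set (UnrSeries 3)) = Ideal.span {L} :=
  Ideal.span_singleton_mul_right_unit hh L

/-! ## §1 The cyclotomic teeth (same definitions as nodes `toothwise_kolyvagin_mu`, `mu_dominance_relative_teeth`) -/

/-- The `k`-th CYCLOTOMIC TOOTH `𝔮_k = Φ_{3^k}(1+T) ∈ Λ = ℤ₃⟦T⟧` (`𝔮_0 = T`). [Washington1997 §7.1] -/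
def tooth (k : ℕ) : IwasawaAlgebra 3 :=
  (((Polynomial.cyclotomic (3 ^ k) ℤ_[3]).comp (Polynomial.X + 1) : Polynomial ℤ_[3]) : PowerSeries ℤ_[3])

/-- The tooth read in the receptacle `R₀⟦T⟧`. [Castella2018 §2.2] -/
def toothUnr (k : ℕ) : UnrSeries 3 :=
  PowerSeries.map (Halves.toUnr 3) (tooth k)

/-- The `R₀⟦T⟧`-length of `R₀⟦T⟧/(𝔮_k, L)` (`= v_{π_k}(L(ζ_{3^k} - 1))`, `⊤` iff `𝔮_k ∣ L`): the value of `L` at the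
tooth read WITHOUT an evaluation map. [Washington1997 §7.1] -/
abbrev toothLengthOf (L : UnrSeries 3) (k : ℕ) : ℕ∞ :=
  Module.length (UnrSeries 3) (UnrSeries 3 ⧸ Ideal.span ({toothUnr k, L} : Set (UnrSeries 3)))

/-- Monotonicity of the tooth length: if `L ∈ (g)` then `ℓ(R/(𝔮_k, g)) ≤ ℓ(R/(𝔮_k, L))`. [folklore] -/
theorem toothLengthOf_le_of_mem_span {g L : UnrSeries 3} (hL : L ∈ Ideal.span ({g} : Set (UnrSeries 3)))
    (k : ℕ) : toothLengthOf g k ≤ toothLengthOf L k := by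
  have hle : Ideal.span ({toothUnr k, L} : Set (UnrSeries 3)) ≤ Ideal.span {toothUnr k, g} := by
    rw [Ideal.span_le]
    intro x hx
    rcases hx with rfl | hx
    · exact Ideal.subset_span (Set.mem_insert _ _)
    · rw [Set.mem_singleton_iff] at hx
      subst hx
      exact (Ideal.span_mono (Set.subset_insert _ _)) hL
  exact Module.length_le_of_surjective (Submodule.factor hle) (Submodule.factor_surjective hle)

/-! ## §2 Pieces (Props) -/

/-- PIECE A (WEAKER than the crux: `pointAnchor_of_wall`). THE POINT ANCHOR AT `𝟙` at additive split 3: at every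
wall frame (binders = the wall's, verbatim) at which `X_(∅,0)(E/K_∞)` is `Λ`-torsion and `L(𝟙) ≠ 0`, for every
generator `f` of `Ch_Λ(X_(∅,0))`: `‖L(𝟙)‖ ≤ ‖f(0)‖`, i.e. `ord₃ f(0) ≤ ord₃ L(𝟙)` — the KOLYVAGIN direction at the
trivial character, SHARP (no error constant). By exact control (UTD 20386) + the unit Waldspurger value (UTD 20385)
it is the Manin-robust index inequality `ord₃#Ш(E/K) + 2·ord₃∏c_q + 2·ord₃c ≤ 2·ord₃[E(K):ℤy_K]`, the conclusion of
SOED 20480 `WildKolyvaginUpperAtThree`; tower-free. The mirror image of SOED 26610 (`‖f(0)‖ ≤ ‖L(𝟙)‖`).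
[JetchevSkinnerWan2017 §7.4; Jetchev2008; Kolyvagin1990; Castella2018 Thm. 2.3] -/
def PointAnchorAtThree : Prop :=
  ∀ (W : WeierstrassCurve ℚ) [W.IsElliptic] [W.IsGloballyMinimal] (N : ℕ) [NeZero N] (K : Type) [Field K]
    [NumberField K] (Dt : Literature.NumberTheory.EllipticCurves.ModularForms.ModularParametrizationData W N),
    Summit.BirchSwinnertonDyer.Rank1Residual.Additive.ClassO6 W 3 → W.HasSurjectiveModNGaloisRep 3 →
    W.analyticRank = 1 → W.conductorNorm ℤ = N → IsImaginaryQuadratic K → SatisfiesHeegnerHypothesis N K →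
    ∀ (κ : ZpExtension K 3), κ.IsAnticyclotomic →
    ∀ (γ : Field.absoluteGaloisGroup K) [Fact (κ.IsTopGenerator γ)]
      (𝔭 : IsDedekindDomain.HeightOneSpectrum (NumberField.RingOfIntegers K)),
      ((3 : ℕ) : NumberField.RingOfIntegers K) ∈ 𝔭.asIdeal →
      𝔭.asIdeal.ramificationIdx (NumberField.RingOfIntegers ℚ) = 1 →
      𝔭.asIdeal.inertiaDeg (NumberField.RingOfIntegers ℚ) = 1 →
      ∀ (𝔭' : IsDedekindDomain.HeightOneSpectrum (NumberField.RingOfIntegers K)),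
        ((3 : ℕ) : NumberField.RingOfIntegers K) ∈ 𝔭'.asIdeal → 𝔭' ≠ 𝔭 →
        ∀ (ι' : PadicAlgCl 3 ≃+* ℂ),
          Summit.BirchSwinnertonDyer.BirchSwinnertonDyer.Theorems.SchneiderFree.BranchInducesPrime 3 ι' 𝔭 →
          ∀ (ΩK : ℂ) (Ωp : ℂ_[3]) (L : UnrSeries 3), ΩK ≠ 0 → Ωp ≠ 0 →
            IsBDPLFunction ι' 𝔭 κ γ Dt.f ΩK Ωp L →
            Module.IsTorsion (IwasawaAlgebra 3) (AcSelmer.XAc (W.baseChange K) 3 κ 𝔭' ∅ γ) →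
            ∀ f : IwasawaAlgebra 3, AcSelmer.XAc.charIdeal (W.baseChange K) 3 κ 𝔭' ∅ γ = Ideal.span {f} →
              PowerSeries.constantCoeff L ≠ 0 →
              ‖((PowerSeries.constantCoeff L : unrIntegers 3) : ℂ_[3])‖ ≤
                ‖((PowerSeries.constantCoeff f : ℤ_[3]) : ℚ_[3])‖

/-- PIECE Door (ATTACKABLE, pure commutative algebra in `R₀⟦T⟧`, M-sized). UNIT DETECTION AT A TOOTH: if
`g = L·h`, the tooth length of `L` at `𝔮_k` is finite (`𝔮_k ∤ L`) and `ℓ(R₀⟦T⟧/(𝔮_k,g)) ≤ ℓ(R₀⟦T⟧/(𝔮_k,L))`, then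
`h` is a unit. Reason: `S = R₀⟦T⟧/𝔮_k ≅ R₀[ζ_{3^k}]` is a DVR (Weierstrass division by the distinguished polynomial
`Φ_{3^k}(1+T)`), `v(ḡ) = v(L̄) + v(h̄)`, so `v(h̄) = 0`, `h̄ ∈ Sˣ`, and `R₀⟦T⟧` is local. [Washington1997 §7.1
Prop. 7.2; SkinnerUrban2014 Lem. 3.1.7] -/
def ToothAnchorDoor : Prop :=
  ∀ (g L h : UnrSeries 3) (k : ℕ), g = L * h → toothLengthOf L k ≠ ⊤ →
    toothLengthOf g k ≤ toothLengthOf L k → IsUnit h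

/-- PIECE Exists (ATTACKABLE, pure algebra, S/M-sized). A NON-ZERO `L ∈ R₀⟦T⟧` HAS A NON-VANISHING TOOTH: some
`𝔮_k` does not divide `L` (the teeth are pairwise non-associated primes of degrees `φ(3^k)`, and
`∑_{𝔮_k ∣ L} φ(3^k) ≤ λ(L)` by Weierstrass preparation). [Washington1997 §7.1] -/
def ExistsNonvanishingTooth : Prop :=
  ∀ L : UnrSeries 3, L ≠ 0 → ∃ k : ℕ, toothLengthOf L k ≠ ⊤

/-- PIECE T (WEAKER than the crux: `toothAnchor_of_wall`). THE TOOTH ANCHOR ON THE CORNER: at every wall frame with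
`X_(∅,0)` torsion, `L ≠ 0` but `L(𝟙) = 0` (so `y_K` is torsion and `r_an(E/K) ≥ 3` — a corner UTD's `closes` never
meets), for every generator `f` of `Ch_Λ(X_(∅,0))` and every tooth `𝔮_k` not dividing `L`:
`ℓ(R₀⟦T⟧/(𝔮_k, f)) ≤ ℓ(R₀⟦T⟧/(𝔮_k, L))`, i.e. `ℓ_{O_k}(X/𝔮_k X) ≤ v_{π_k}(L(ζ_{3^k}−1))` read through control at
`𝔮_k` — a SINGLE-LAYER sharp Kolyvagin inequality for the `χ_k`-component (individual class `y_{χ_k}`; no trace, no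
norm-compatible family) paired with the finite-order `p`-adic Waldspurger value at `χ_k`.
[BertoliniDarmon1990; LiuZhangZhang2018 Thm. 1.5.1; Castella2018 §2.2] -/
def ToothAnchorAtThree : Prop :=
  ∀ (W : WeierstrassCurve ℚ) [W.IsElliptic] [W.IsGloballyMinimal] (N : ℕ) [NeZero N] (K : Type) [Field K]
    [NumberField K] (Dt : Literature.NumberTheory.EllipticCurves.ModularForms.ModularParametrizationData W N),
    Summit.BirchSwinnertonDyer.Rank1Residual.Additive.ClassO6 W 3 → W.HasSurjectiveModNGaloisRep 3 →
    W.analyticRank = 1 → W.conductorNorm ℤ = N → IsImaginaryQuadratic K → SatisfiesHeegnerHypothesis N K →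
    ∀ (κ : ZpExtension K 3), κ.IsAnticyclotomic →
    ∀ (γ : Field.absoluteGaloisGroup K) [Fact (κ.IsTopGenerator γ)]
      (𝔭 : IsDedekindDomain.HeightOneSpectrum (NumberField.RingOfIntegers K)),
      ((3 : ℕ) : NumberField.RingOfIntegers K) ∈ 𝔭.asIdeal →
      𝔭.asIdeal.ramificationIdx (NumberField.RingOfIntegers ℚ) = 1 →
      𝔭.asIdeal.inertiaDeg (NumberField.RingOfIntegers ℚ) = 1 →
      ∀ (𝔭' : IsDedekindDomain.HeightOneSpectrum (NumberField.RingOfIntegers K)),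
        ((3 : ℕ) : NumberField.RingOfIntegers K) ∈ 𝔭'.asIdeal → 𝔭' ≠ 𝔭 →
        ∀ (ι' : PadicAlgCl 3 ≃+* ℂ),
          Summit.BirchSwinnertonDyer.BirchSwinnertonDyer.Theorems.SchneiderFree.BranchInducesPrime 3 ι' 𝔭 →
          ∀ (ΩK : ℂ) (Ωp : ℂ_[3]) (L : UnrSeries 3), ΩK ≠ 0 → Ωp ≠ 0 →
            IsBDPLFunction ι' 𝔭 κ γ Dt.f ΩK Ωp L →
            Module.IsTorsion (IwasawaAlgebra 3) (AcSelmer.XAc (W.baseChange K) 3 κ 𝔭' ∅ γ) →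
            ∀ f : IwasawaAlgebra 3, AcSelmer.XAc.charIdeal (W.baseChange K) 3 κ 𝔭' ∅ γ = Ideal.span {f} →
              L ≠ 0 → PowerSeries.constantCoeff L = 0 →
              ∀ k : ℕ, toothLengthOf L k ≠ ⊤ →
                toothLengthOf (PowerSeries.map (Halves.toUnr 3) f) k ≤ toothLengthOf L k

/-! ## §3 Registered stubs (the ONLY `sorry`s) -/

/-- STUB E (UNDECIDED — SOED route item stmt-BirchSwinnertonDyer-20479 BY NAME: the Eisenstein inclusion). -/
theorem stub_eisenstein : WildSplitEisensteinInclusionAtThree := by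
  sorry

/-- STUB A (WEAKER — piece A, the point anchor at `𝟙`; `pointAnchor_of_wall`). -/
theorem stub_pointAnchor : PointAnchorAtThree := by
  sorry

/-- STUB Door (ATTACKABLE — pure algebra). -/
theorem stub_toothDoor : ToothAnchorDoor := by
  sorry

/-- STUB Exists (ATTACKABLE — pure algebra). -/
theorem stub_existsTooth : ExistsNonvanishingTooth := by
  sorry

/-- STUB T (WEAKER — piece T, the tooth anchor on the corner `L(𝟙) = 0`; `toothAnchor_of_wall`). -/
theorem stub_toothAnchor : ToothAnchorAtThree := by
  sorry

/-! ## §4 Tags WEAKER (kernel-checked): the crux implies A and T -/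

/-- THE WALL ⟹ the point anchor: `(L) ⊆ (f')` gives `L = f'·h`, `‖L(0)‖ = ‖f'(0)‖·‖h(0)‖ ≤ ‖f'(0)‖ = ‖f(0)‖`. -/
theorem pointAnchor_of_wall : AdditiveSplitIMCInclusionAtThree → PointAnchorAtThree := by
  intro hW W _ _ N _ K _ _ Dt hO6 hsurj hr1 hN hK hH κ hκ γ _ 𝔭 h3 he hf 𝔭' h3' hne ι' hι ΩK Ωp L hΩK hΩp hL
    _hT f hfc _hL0
  have h := hW W N K Dt hO6 hsurj hr1 hN hK hH κ hκ γ 𝔭 h3 he hf 𝔭' h3' hne ι' hι ΩK Ωp L hΩK hΩp hL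
  rw [hfc, Ideal.map_span, Set.image_singleton] at h
  have hLmem : L ∈ Ideal.span ({PowerSeries.map (Halves.toUnr 3) f} : Set (UnrSeries 3)) :=
    h (Ideal.mem_span_singleton_self L)
  obtain ⟨a, ha⟩ := Ideal.mem_span_singleton'.mp hLmem
  have hc : (PowerSeries.constantCoeff L : unrIntegers 3) =
      PowerSeries.constantCoeff a * Halves.toUnr 3 (PowerSeries.constantCoeff f) := by
    rw [← ha, map_mul, constantCoeff_map_apply']
  have hnf : ‖((Halves.toUnr 3 (PowerSeries.constantCoeff f) : unrIntegers 3) : ℂ_[3])‖ =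
      ‖((PowerSeries.constantCoeff f : ℤ_[3]) : ℚ_[3])‖ := by
    rw [coe_toUnr, norm_algebraMap']
  rw [hc, Subring.coe_mul, norm_mul, hnf]
  calc ‖((PowerSeries.constantCoeff a : unrIntegers 3) : ℂ_[3])‖ * ‖((PowerSeries.constantCoeff f : ℤ_[3]) : ℚ_[3])‖
      ≤ 1 * ‖((PowerSeries.constantCoeff f : ℤ_[3]) : ℚ_[3])‖ :=
        mul_le_mul_of_nonneg_right (norm_coe_unrIntegers_le_one 3 _) (norm_nonneg _)
    _ = ‖((PowerSeries.constantCoeff f : ℤ_[3]) : ℚ_[3])‖ := one_mul _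

/-- THE WALL ⟹ the tooth anchor: `L ∈ (f')` makes `R₀⟦T⟧/(𝔮_k, f')` a quotient of `R₀⟦T⟧/(𝔮_k, L)`. -/
theorem toothAnchor_of_wall : AdditiveSplitIMCInclusionAtThree → ToothAnchorAtThree := by
  intro hW W _ _ N _ K _ _ Dt hO6 hsurj hr1 hN hK hH κ hκ γ _ 𝔭 h3 he hf 𝔭' h3' hne ι' hι ΩK Ωp L hΩK hΩp hL
    _hT f hfc _hLz _hL0 k _hk
  have h := hW W N K Dt hO6 hsurj hr1 hN hK hH κ hκ γ 𝔭 h3 he hf 𝔭' h3' hne ι' hι ΩK Ωp L hΩK hΩp hL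
  rw [hfc, Ideal.map_span, Set.image_singleton] at h
  exact toothLengthOf_le_of_mem_span (h (Ideal.mem_span_singleton_self L)) k

/-! ## §5 THE KERNEL: E → A → Door → Exists → T → THE WALL (concludes the crux BY NAME) -/

/-- **The wall off the corner, from the Eisenstein inclusion and the point anchor alone** (kernel-checked): at every
frame with `L(𝟙) ≠ 0` the inclusion `(L) ⊆ Ch·R₀⟦T⟧` holds given E and A. Off the torsion locus the inclusion is
vacuous (landed `span_le_map_charIdeal_of_not_isTorsion`); on it, `Ch = (f)` (landed `charIdeal_isPrincipal_holds`),
E gives `f' = L·h`, A gives `‖L(0)‖ ≤ ‖L(0)·h(0)‖`, the §0 algebra gives `h ∈ R₀⟦T⟧ˣ`. [SkinnerUrban2014 Lem. 3.1.7] -/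
theorem wallOffCorner_of (hE : WildSplitEisensteinInclusionAtThree) (hA : PointAnchorAtThree) :
    ∀ (W : WeierstrassCurve ℚ) [W.IsElliptic] [W.IsGloballyMinimal] (N : ℕ) [NeZero N] (K : Type) [Field K]
    [NumberField K] (Dt : Literature.NumberTheory.EllipticCurves.ModularForms.ModularParametrizationData W N),
    Summit.BirchSwinnertonDyer.Rank1Residual.Additive.ClassO6 W 3 → W.HasSurjectiveModNGaloisRep 3 →
    W.analyticRank = 1 → W.conductorNorm ℤ = N → IsImaginaryQuadratic K → SatisfiesHeegnerHypothesis N K →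
    ∀ (κ : ZpExtension K 3), κ.IsAnticyclotomic →
    ∀ (γ : Field.absoluteGaloisGroup K) [Fact (κ.IsTopGenerator γ)]
      (𝔭 : IsDedekindDomain.HeightOneSpectrum (NumberField.RingOfIntegers K)),
      ((3 : ℕ) : NumberField.RingOfIntegers K) ∈ 𝔭.asIdeal →
      𝔭.asIdeal.ramificationIdx (NumberField.RingOfIntegers ℚ) = 1 →
      𝔭.asIdeal.inertiaDeg (NumberField.RingOfIntegers ℚ) = 1 →
      ∀ (𝔭' : IsDedekindDomain.HeightOneSpectrum (NumberField.RingOfIntegers K)),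
        ((3 : ℕ) : NumberField.RingOfIntegers K) ∈ 𝔭'.asIdeal → 𝔭' ≠ 𝔭 →
        ∀ (ι' : PadicAlgCl 3 ≃+* ℂ),
          Summit.BirchSwinnertonDyer.BirchSwinnertonDyer.Theorems.SchneiderFree.BranchInducesPrime 3 ι' 𝔭 →
          ∀ (ΩK : ℂ) (Ωp : ℂ_[3]) (L : UnrSeries 3), ΩK ≠ 0 → Ωp ≠ 0 →
            IsBDPLFunction ι' 𝔭 κ γ Dt.f ΩK Ωp L → PowerSeries.constantCoeff L ≠ 0 →
            Ideal.span {L} ≤ (AcSelmer.XAc.charIdeal (W.baseChange K) 3 κ 𝔭' ∅ γ).map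
              (PowerSeries.map (Halves.toUnr 3)) := by
  intro W _ _ N _ K _ _ Dt hO6 hsurj hr1 hN hK hH κ hκ γ _ 𝔭 h3 he hf 𝔭' h3' hne ι' hι ΩK Ωp L hΩK hΩp hL hL0
  by_cases hT : Module.IsTorsion (IwasawaAlgebra 3) (AcSelmer.XAc (W.baseChange K) 3 κ 𝔭' ∅ γ)
  swap
  · -- off the torsion locus `Ch = ⊤` (landed vacuity theorem, algebra form: the wall's `S = (∅ : Set _)`)
    exact span_le_map_charIdeal_of_not_isTorsion hT (PowerSeries.map (Halves.toUnr 3)) L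
  obtain ⟨f, hf₀⟩ := (charIdeal_isPrincipal_holds 3 (AcSelmer.XAc (W.baseChange K) 3 κ 𝔭' ∅ γ)).principal
  have hfc : AcSelmer.XAc.charIdeal (W.baseChange K) 3 κ 𝔭' ∅ γ = Ideal.span {f} := hf₀
  have hEle := hE W N K Dt hO6 hsurj hr1 hN hK hH κ hκ γ 𝔭 h3 he hf 𝔭' h3' hne ι' hι ΩK Ωp L hΩK hΩp hL hT
  rw [hfc, Ideal.map_span, Set.image_singleton] at hEle ⊢
  obtain ⟨h, hh⟩ := Ideal.mem_span_singleton'.mp (hEle (Ideal.mem_span_singleton_self _))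
  -- `hh : h * L = map f`
  have hAle := hA W N K Dt hO6 hsurj hr1 hN hK hH κ hκ γ 𝔭 h3 he hf 𝔭' h3' hne ι' hι ΩK Ωp L hΩK hΩp hL hT f hfc hL0
  have hc : Halves.toUnr 3 (PowerSeries.constantCoeff f) =
      (PowerSeries.constantCoeff L : unrIntegers 3) * PowerSeries.constantCoeff h := by
    rw [← constantCoeff_map_apply', ← hh, map_mul, mul_comm]
  have hnf : ‖((PowerSeries.constantCoeff f : ℤ_[3]) : ℚ_[3])‖ =
      ‖((Halves.toUnr 3 (PowerSeries.constantCoeff f) : unrIntegers 3) : ℂ_[3])‖ := by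
    rw [coe_toUnr, norm_algebraMap']
  rw [hnf, hc] at hAle
  have hu : IsUnit h := PowerSeries.isUnit_iff_constantCoeff.mpr (isUnit_of_norm_mul_le hL0 hAle)
  rw [← hh, mul_comm, span_mul_eq_of_isUnit hu]

/-- **THE WALL from the Eisenstein inclusion, the point anchor, the tooth door, a non-vanishing tooth and the tooth
anchor** — concludes the crux `AdditiveSplitIMCInclusionAtThree` BY NAME. Frames with `L(𝟙) ≠ 0`: `wallOffCorner_of`.
`L = 0`: `(0) = ⊥`. Corner `L ≠ 0 = L(𝟙)`: on the torsion locus, `f' = L·h` (E), a tooth `𝔮_k ∤ L` (Exists), the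
single-tooth inequality (T) and the door give `h ∈ R₀⟦T⟧ˣ`. [SkinnerUrban2014 Lem. 3.1.7; Washington1997 §13.2] -/
theorem AdditiveSplitIMCInclusionAtThree_of :
    WildSplitEisensteinInclusionAtThree → PointAnchorAtThree → ToothAnchorDoor → ExistsNonvanishingTooth →
      ToothAnchorAtThree → AdditiveSplitIMCInclusionAtThree := by
  intro hE hA hD hX hTth W _ _ N _ K _ _ Dt hO6 hsurj hr1 hN hK hH κ hκ γ _ 𝔭 h3 he hf 𝔭' h3' hne ι' hι ΩK Ωp L
    hΩK hΩp hL
  by_cases hL0 : PowerSeries.constantCoeff L = 0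
  swap
  · exact wallOffCorner_of hE hA W N K Dt hO6 hsurj hr1 hN hK hH κ hκ γ 𝔭 h3 he hf 𝔭' h3' hne ι' hι ΩK Ωp L hΩK
      hΩp hL hL0
  by_cases hLz : L = 0
  · subst hLz
    rw [Ideal.span_singleton_eq_bot.mpr rfl]
    exact bot_le
  by_cases hT : Module.IsTorsion (IwasawaAlgebra 3) (AcSelmer.XAc (W.baseChange K) 3 κ 𝔭' ∅ γ)
  swap
  · -- off the torsion locus `Ch = ⊤` (landed vacuity theorem, algebra form: the wall's `S = (∅ : Set _)`)
    exact span_le_map_charIdeal_of_not_isTorsion hT (PowerSeries.map (Halves.toUnr 3)) L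
  obtain ⟨f, hf₀⟩ := (charIdeal_isPrincipal_holds 3 (AcSelmer.XAc (W.baseChange K) 3 κ 𝔭' ∅ γ)).principal
  have hfc : AcSelmer.XAc.charIdeal (W.baseChange K) 3 κ 𝔭' ∅ γ = Ideal.span {f} := hf₀
  have hEle := hE W N K Dt hO6 hsurj hr1 hN hK hH κ hκ γ 𝔭 h3 he hf 𝔭' h3' hne ι' hι ΩK Ωp L hΩK hΩp hL hT
  rw [hfc, Ideal.map_span, Set.image_singleton] at hEle ⊢
  obtain ⟨h, hh⟩ := Ideal.mem_span_singleton'.mp (hEle (Ideal.mem_span_singleton_self _))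
  obtain ⟨k, hk⟩ := hX L hLz
  have hTle := hTth W N K Dt hO6 hsurj hr1 hN hK hH κ hκ γ 𝔭 h3 he hf 𝔭' h3' hne ι' hι ΩK Ωp L hΩK hΩp hL hT f hfc
    hLz hL0 k hk
  have hu : IsUnit h := hD (PowerSeries.map (Halves.toUnr 3) f) L h k (by rw [← hh, mul_comm]) hk hTle
  rw [← hh, mul_comm, span_mul_eq_of_isUnit hu]

/-- The node's five stubs compose to the crux (the registered composition, restated on the stubs). -/
theorem AdditiveSplitIMCInclusionAtThree_holds_of_stubs : AdditiveSplitIMCInclusionAtThree :=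
  AdditiveSplitIMCInclusionAtThree_of stub_eisenstein stub_pointAnchor stub_toothDoor stub_existsTooth
    stub_toothAnchor

end Summit.BirchSwinnertonDyer.BirchSwinnertonDyer.Cruxes.AdditiveSplitIMCInclusionAtThree.PointAnchor

end
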